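import Summits.QuantumFields.YangMills.Theorems.SmallFieldWideningLargeFieldMassRefinementTailRated
import Summits.QuantumFields.YangMills.Theorems.SmallFieldWideningLargeFieldMassRefinementTailOfOneRecord
import HarnessLib

/-!
# Route `SmallFieldWidening`, crux r3 `LargeFieldMassRefinementTail` (stmt-QuantumFields-22884) — ONE (α) χ-RECORD PER ODD BLOCK SIZE CLOSES
# ALL THREE K2-TYPE ITEMS BY NAME: r3 (22884), `HistoryTail` (18916) AND `HistoryTailL` (19936)
# (support file, leaf; width seat `ym-line-sfw-p2-w3` gen 4, line `birth`)

WHY.  The lead's `…OfOneRecord` (gen 2) proved: ONE primitive-constants record `𝔠 : AlphaConsts L 2` per odd `L > 1` with the χ-package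
`AlphaInputsT3AC.OfV3ChiAt` (at ANY single profile, at ANY [7]-constants `0 < a₁`, `𝔠.B₃ a₁ ≤ a₀`) already gives the averaged-heights package
`AveragedTailAt` at the record's own profile, hence r3 — strictly less than the shared registered stub 2′χ `AlphaInputsT3ACv3RecChi` of cruxes
19936 / 20520 (a record at EVERY profile beyond arbitrary thresholds).  The sibling file `…Rated` shows the averaged-heights package at ONE
profile is a hub (r3⁺ ⇒ `HistoryTail` ∧ `HistoryTailL` ∧ r3; thresholds are free by profile monotonicity, the profile is fixed before `m`).
Composing the two: **the first χ-record the (α) lane exhibits closes 18916, 19936 and 22884 alike** — recorded here BY NAME so the harness /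
planner can key all three items to the same weakest feeder.

* `rated_of_oneIntCore`, `rated_of_oneChiRecord` — r3⁺ from one `IntCoreRec`-body record / one χ-record per odd `L`.
* ★★ `historyTailL_of_oneChiRecord : … → Theses.UnitScaleTilt.HistoryTailL`, ★ `historyTail_of_oneChiRecord : … → Theses.UnitScaleTilt.HistoryTail`,
  `historyTailL_of_oneIntCore`.  (Through `…OfOneRecord.oneChiRecord_of_laneRecordsChi` the registered 2′χ text gives the same conclusion as the
  lane's own `HistoryTailLaneTailChi.historyTailL_of_laneRecordsChi` — not restated here, the gate's dedup forbids the copy.)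

WHAT THIS IS NOT: no record is constructed (the (α) lane's (T) [7] Thm 1 + (FL) fine lifts + (O″χ) data rows are OPEN); r3, K2, K2-L stay OPEN;
nothing here bears on d = 4 or the Yang–Mills mass gap (rung R3 record only).

References: T. Bałaban, CMP 102 (1985) 255–275 [Balaban1985UV3] ((5) p.256, (47) p.267, (71) p.273, Thm 2 p.272); CMP 102 (1985) 277–309
[Balaban1985Variational] (Thm 1 (8) p.279); C. King, CMP 102 (1986) 649–677 [King1986] ((3.12) p.657).
-/

set_option autoImplicit false

noncomputable section

open MeasureTheory Filter Topology
open Literature.MathematicalPhysics.QuantumFieldTheory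
open Literature.MathematicalPhysics.QuantumFieldTheory.Balaban1983to89
open Literature.MathematicalPhysics.QuantumFieldTheory.Balaban1983to89.Missing
open Literature.MathematicalPhysics.QuantumFieldTheory.Balaban1983to89.T3ContinuumYM3Torus
open Literature.MathematicalPhysics.QuantumFieldTheory.Balaban1983to89.T3UnitScaleTilt
open Literature.MathematicalPhysics.QuantumFieldTheory.Balaban1983to89.T3UnitLawDensityEML
open Literature.MathematicalPhysics.QuantumFieldTheory.Balaban1983to89.T3BareTailProfile
open Literature.MathematicalPhysics.QuantumFieldTheory.Balaban1983to89.T3AlphaInputsAC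
open Literature.MathematicalPhysics.QuantumFieldTheory.Balaban1983to89.T3AlphaInputsACSchemas
open Summit.QuantumFields.Balaban3D.Carriers (suGroupModel Hist)
open Summit.QuantumFields.Balaban3D.Proofs.Primitives (AlphaConsts)
open Summit.QuantumFields.YangMills.Theorems
open Summit.QuantumFields.YangMills.Theorems.LargeFieldMassRefinementTailOfOneRecord
  (averagedTailPkg_of_oneIntCore intCoreBody_of_ofV3ChiAt)
open Summit.QuantumFields.YangMills.Theorems.LargeFieldMassRefinementTailRated
  (rated_of_averagedTail historyTailL_of_rated historyTail_of_rated)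

namespace Summit.QuantumFields.YangMills.Theorems.LargeFieldMassRefinementTailRatedOfOneRecord

/-- **r3⁺ FROM ONE `IntCoreRec`-BODY RECORD PER ODD BLOCK SIZE** (`averagedTailPkg_of_oneIntCore`, then `rated_of_averagedTail`).
[cite: Balaban1985UV3, (5) p.256, (47) p.267 and (71) p.273] -/
theorem rated_of_oneIntCore
    (hone : ∀ (L : ℕ), Odd L → 1 < L →
      ∃ (𝔠 : AlphaConsts L (suGroupModel 2).N) (a₁ : ℝ), 0 < a₁ ∧
        ∀ (F : T3Family) (hF : F.L = L) (γ : ℝ) (hγ : 0 < γ) (hγ1 : γ ≤ (min (hF ▸ 𝔠).gamma0 1) ^ 2),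
          ∃ qf : ∀ K, AlphaInputsT3AC.PkgCoreV3 F (hF ▸ 𝔠) γ hγ hγ1 K, (∀ K, (qf K).a₁ = a₁) ∧
            ((∀ i, θBal F.L γ (hF ▸ 𝔠).b₀ (hF ▸ 𝔠).p₀ i ≤ a₁) →
              ∀ (π : AlphaInputsT3AC.PolymerT3 F) (K j : ℕ), j ≤ K → Ineq47AE (AlphaInputsT3AC.dataIntV3 qf π) K j)) :
    ∀ L : ℕ, ∃ b₀ p₀ γ₁ : ℝ, 0 < b₀ ∧ 2 < p₀ ∧ 0 < γ₁ ∧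
      ∀ (F : T3Family) (γ : ℝ), F.L = L → 0 < γ → ∃ δ : ℕ → ℝ, Summable δ ∧
        ∀ n K : ℕ, γ * ((F.L : ℝ)⁻¹) ^ n ≤ γ₁ →
          (gibbsK (F.refine n) ℰp (γ * ((F.L : ℝ)⁻¹) ^ n) K).real
            (histGood (F.refine n) ℰp (θBal (F.refine n).L (γ * ((F.L : ℝ)⁻¹) ^ n) b₀ p₀) K 0)ᶜ ≤ δ n :=
  rated_of_averagedTail (averagedTailPkg_of_oneIntCore hone)

/-- **r3⁺ FROM ONE χ-RECORD PER ODD BLOCK SIZE `L > 1`, AT ANY CONSTANTS** (`intCoreBody_of_ofV3ChiAt` per family, then `rated_of_oneIntCore`).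
[cite: Balaban1985UV3, (47) p.267, Thm 2 p.272 and (71) p.273; Balaban1985Variational, Thm 1 (8) p.279] -/
theorem rated_of_oneChiRecord
    (hone : ∀ (L : ℕ), Odd L → 1 < L →
      ∃ (𝔠 : AlphaConsts L (suGroupModel 2).N) (a₀ a₁ : ℝ), 0 < a₀ ∧ 0 < a₁ ∧ 𝔠.B₃ * a₁ ≤ a₀ ∧
        ∀ (F : T3Family) (hF : F.L = L), AlphaInputsT3AC.OfV3ChiAt F (hF ▸ 𝔠) a₀ a₁) :
    ∀ L : ℕ, ∃ b₀ p₀ γ₁ : ℝ, 0 < b₀ ∧ 2 < p₀ ∧ 0 < γ₁ ∧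
      ∀ (F : T3Family) (γ : ℝ), F.L = L → 0 < γ → ∃ δ : ℕ → ℝ, Summable δ ∧
        ∀ n K : ℕ, γ * ((F.L : ℝ)⁻¹) ^ n ≤ γ₁ →
          (gibbsK (F.refine n) ℰp (γ * ((F.L : ℝ)⁻¹) ^ n) K).real
            (histGood (F.refine n) ℰp (θBal (F.refine n).L (γ * ((F.L : ℝ)⁻¹) ^ n) b₀ p₀) K 0)ᶜ ≤ δ n := by
  refine rated_of_oneIntCore fun L hLo hL => ?_
  obtain ⟨𝔠, a₀, a₁, ha0, ha1, hw, hF⟩ := hone L hLo hL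
  refine ⟨𝔠, a₁, ha1, fun F hFL γ hγ hγ1 => ?_⟩
  subst hFL
  exact intCoreBody_of_ofV3ChiAt (hF F rfl) ⟨ha0, ha1, hw⟩ γ hγ hγ1

/-- ★★ **ONE χ-RECORD PER ODD BLOCK SIZE CLOSES K2-L `HistoryTailL` (stmt-QuantumFields-19936) BY NAME** — at ANY single profile: thresholds
`(b₁, p₁)` are served by profile monotonicity (`…Rated.historyTailL_of_rated`), the profile is fixed before `m`, one `γ₁` serves every `m`.
Strictly weaker hypothesis than 19936's registered stub 2′χ (records at EVERY profile beyond thresholds).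
[cite: Balaban1985UV3, (47) p.267, Thm 2 p.272 and (71) p.273; Balaban1985Variational, Thm 1 (8) p.279; King1986, (3.12) p.657] -/
theorem historyTailL_of_oneChiRecord
    (hone : ∀ (L : ℕ), Odd L → 1 < L →
      ∃ (𝔠 : AlphaConsts L (suGroupModel 2).N) (a₀ a₁ : ℝ), 0 < a₀ ∧ 0 < a₁ ∧ 𝔠.B₃ * a₁ ≤ a₀ ∧
        ∀ (F : T3Family) (hF : F.L = L), AlphaInputsT3AC.OfV3ChiAt F (hF ▸ 𝔠) a₀ a₁) :
    Summit.QuantumFields.YangMills.Theses.UnitScaleTilt.HistoryTailL :=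
  historyTailL_of_rated (rated_of_oneChiRecord hone)

/-- ★ **ONE χ-RECORD PER ODD BLOCK SIZE CLOSES K2 `HistoryTail` (stmt-QuantumFields-18916) BY NAME** — one profile and one `γ₁` for every free top
fraction `1/m`. [cite: Balaban1985UV3, (47) p.267, Thm 2 p.272 and (71) p.273; Balaban1985Variational, Thm 1 (8) p.279] -/
theorem historyTail_of_oneChiRecord
    (hone : ∀ (L : ℕ), Odd L → 1 < L →
      ∃ (𝔠 : AlphaConsts L (suGroupModel 2).N) (a₀ a₁ : ℝ), 0 < a₀ ∧ 0 < a₁ ∧ 𝔠.B₃ * a₁ ≤ a₀ ∧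
        ∀ (F : T3Family) (hF : F.L = L), AlphaInputsT3AC.OfV3ChiAt F (hF ▸ 𝔠) a₀ a₁) :
    Summit.QuantumFields.YangMills.Theses.UnitScaleTilt.HistoryTail :=
  historyTail_of_rated (rated_of_oneChiRecord hone)

/-- **`HistoryTailL` FROM ONE `IntCoreRec`-BODY RECORD PER ODD BLOCK SIZE** (the record-free interior reading of the same).
[cite: Balaban1985UV3, (5) p.256, (47) p.267 and (71) p.273; King1986, (3.12) p.657] -/
theorem historyTailL_of_oneIntCore
    (hone : ∀ (L : ℕ), Odd L → 1 < L →
      ∃ (𝔠 : AlphaConsts L (suGroupModel 2).N) (a₁ : ℝ), 0 < a₁ ∧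
        ∀ (F : T3Family) (hF : F.L = L) (γ : ℝ) (hγ : 0 < γ) (hγ1 : γ ≤ (min (hF ▸ 𝔠).gamma0 1) ^ 2),
          ∃ qf : ∀ K, AlphaInputsT3AC.PkgCoreV3 F (hF ▸ 𝔠) γ hγ hγ1 K, (∀ K, (qf K).a₁ = a₁) ∧
            ((∀ i, θBal F.L γ (hF ▸ 𝔠).b₀ (hF ▸ 𝔠).p₀ i ≤ a₁) →
              ∀ (π : AlphaInputsT3AC.PolymerT3 F) (K j : ℕ), j ≤ K → Ineq47AE (AlphaInputsT3AC.dataIntV3 qf π) K j)) :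
    Summit.QuantumFields.YangMills.Theses.UnitScaleTilt.HistoryTailL :=
  historyTailL_of_rated (rated_of_oneIntCore hone)

end Summit.QuantumFields.YangMills.Theorems.LargeFieldMassRefinementTailRatedOfOneRecord

end
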